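/-
Copyright: cell pub-balaban-gaps (YM BLITZ Y1, track G1), seat g1-p2 GEN 7 (unit `pub-balaban-gaps-g1-p2`).  Row (D4) NODE O,
OBJECT level: Cor. 3.5's step for the covariant Laplacian (plus a cube-local averaging correction) in an EXPONENTIATED small background
`U⁺ = e^{X}`, `U⁻ = e^{−X}` under the two (3.37)-SHAPED WINDOWS ON `X` ITSELF (`X = iηA(b)` in print), by `D4WalkBlockExpWindow`'s
exponential window and `D4WalkBlockTransportWindows`' END.  HONEST FRAMING: `X_μ(u, x)` is a hypothesis family (entries of `e^{±X(u)}`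
holomorphic in `u` assumed); (D4) instance 0∕1; NOT BetaPertH, NOT continuum, NOT Clay.
-/
import Summits.QuantumFields.BalabanUV.Gaps.D4WalkBlockTransportWindows
import Summits.QuantumFields.BalabanUV.Gaps.D4WalkBlockExpWindow

/-!
# `Gaps.D4WalkBlockExpTransport` — Cor. 3.5's step for `U = e^{X}` under (3.37)-shaped windows on `X` (cell pub-balaban-gaps, g1-p2 gen 7)

HONEST DEPENDENCY (cell pub-balaban, verbatim): continuum YM on T⁴ ⇐ BetaPertH ∧ nine spine estimates (0/9 proved);
BetaPertH ⇐ (D1) ∧ (D4) ∧ CAP+tail.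

* **`blockWalkExpansion_expTransport_oneScaleTorus`** — 60b's END for `U⁺_μ(u, x) = e^{X_μ(u,x)}`, `U⁻ = e^{−X}` under the windows: row ∕
  column sums of `X_μ(u, x)` at most `ηa₀` and of `X_μ(u, x) − X_μ(u, x − e_μ)` at most `η²a₁`; letters `α₀ = a₀e^{a₀}`, `α₁ = a₁e^{a₀}`.
References: T. Bałaban, Comm. Math. Phys. **99** (1985) 389–434 [B9], (3.37) p. 396, (3.50)–(3.54) pp. 400–401, Cor. 3.5 p. 407.
-/

noncomputable section

namespace Summit.QuantumFields.BalabanUV.Gaps.D4WalkBlockExpTransport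

open Metric Set Finset NormedSpace
open scoped Matrix
open Literature.MathematicalPhysics.QuantumFieldTheory.Balaban1983to89
open Literature.MathematicalPhysics.QuantumFieldTheory.Balaban1983to89.B9SectDWalk (DomBy)
open Literature.MathematicalPhysics.QuantumFieldTheory.Balaban1983to89.B9Thm34Ext (toB6)
open Literature.MathematicalPhysics.QuantumFieldTheory.Balaban1983to89.B9Thm37GlueTorus (torusGeom tdist1)
open Literature.MathematicalPhysics.QuantumFieldTheory.Balaban1983to89.TreeLengthTorus (TPt)
open Literature.MathematicalPhysics.QuantumFieldTheory.Balaban1983to89.B5TorusCover (UT)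
open Literature.MathematicalPhysics.QuantumFieldTheory.Balaban1983to89.B11SectG (RowSum)
open Literature.MathematicalPhysics.QuantumFieldTheory.Balaban1983to89.B5Ineq137Torus (Nv)
open Literature.MathematicalPhysics.QuantumFieldTheory.Balaban1983to89.B6Prop22OneScaleTorus (Index)
open Literature.MathematicalPhysics.QuantumFieldTheory.Balaban1983to89.B1RG242Torus (tower deriv)
open Summit.QuantumFields.BalabanUV.Gaps.D4WalkBlock (blockNorm BlockWalkExpansion)
open Summit.QuantumFields.BalabanUV.Gaps.D4WalkBlockFlatLetters (cubeOf)
open Summit.QuantumFields.BalabanUV.Gaps.D4WalkBlockCovariantShift (covDop covB covShift)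
open Summit.QuantumFields.BalabanUV.Gaps.D4WalkBlockTransportAlgebra (conjOp rowSumNorm colSumNorm)
open Summit.QuantumFields.BalabanUV.Gaps.D4WalkBlockTransportWindows (blockWalkExpansion_transport_oneScaleTorus)
open Summit.QuantumFields.BalabanUV.Gaps.D4WalkBlockExpWindow

section ExpTransport

variable {d L : ℕ} {a msq : ℝ}
variable {dd N' : ℕ} {E : Type*} [NormedAddCommGroup E] [NormedSpace ℂ E]

/-- **[B9] COR. 3.5's STEP FOR THE COVARIANT LAPLACIAN IN AN EXPONENTIATED SMALL BACKGROUND ((3.37) ⇒ letters ⇒ expansion).**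
There are `δ₀, C > 0` (B6's) such that for every member `i` of the one-scale torus family, every `N`, every family of bond fields
`X_μ(u, x) ∈ Matrix (Fin N) (Fin N) ℂ` (`X = iηA(x, x + e_μ)` in print) whose exponentials `e^{±X_μ(u,x)}` have holomorphic entries on a
ball and which satisfies the two (3.37)-shaped WINDOWS there — row and column sums of `X_μ(u, x)` at most `ηa₀` (print: `|A| < α₁(Lʲη)⁻¹`,
one power of `η` from the lattice units) and of `X_μ(u, x) − X_μ(u, x − e_μ)` at most `η²a₁` (print: `|∇A| < α₁(Lʲη)⁻²`) —, every cube row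
sum `(μ, c_μ)`, every holomorphic cube-local averaging correction `V_av` (row sums `≤ α_av`), rates `0 ≤ μ`, `2μ ≤ ε`, `2μ ≤ ½δ₀ − ε − μ`
and the MARGIN of `D4WalkBlockTransportWindows` with `α₀ = a₀e^{a₀}`, `α₁ = a₁e^{a₀}`: with the transporters `U⁺ = e^{X}`, `U⁻ = e^{−X}`
and their defects, `(G′ ⊗ 1)(1 − (V_W(u) + V_av(u))(G′ ⊗ 1))⁻¹` is a block walk expansion with derivative letters — constants uniform in
`K` and the volume, explicit in `(a₀, a₁, α_av, d, N)`.
[cite: Balaban1985BackgroundPropagators, (3.37) p.396, (3.50)–(3.54) pp.400–401, Cor. 3.5 p.407; Balaban1984PropagatorsII, Prop. 2.2 (2.67) p.234] -/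
theorem blockWalkExpansion_expTransport_oneScaleTorus (hd : 1 ≤ d) (hL : Odd L ∧ 1 < L) (ha : 0 < a) (hmsq : 0 ≤ msq) :
    ∃ δ₀ C : ℝ, 0 < δ₀ ∧ 0 < C ∧ ∀ (i : Index d L) (N : ℕ) (c₀ : B13.Consts) (X : Finset (UT (Nv i.P i.P.K))) (R : ℝ)
      (Xf : Fin i.P.d → E → Site i.P 0 → Matrix (Fin N) (Fin N) ℂ)
      (Vav : E → Matrix (Site i.P 0 × (Fin N × Fin N)) (Site i.P 0 × (Fin N × Fin N)) ℂ) (a₀ a₁ αav ε μ cμ : ℝ),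
      (∀ ν x a' c, DifferentiableOn ℂ (fun u => exp (Xf ν u x) a' c) (ball (0 : E) R)) →
      (∀ ν x a' c, DifferentiableOn ℂ (fun u => exp (-Xf ν u x) a' c) (ball (0 : E) R)) →
      (∀ p q, DifferentiableOn ℂ (fun u => Vav u p q) (ball (0 : E) R)) →
      0 ≤ a₀ → 0 ≤ a₁ → 0 ≤ αav →
      (∀ ν, ∀ u ∈ ball (0 : E) R, ∀ x a', rowSumNorm (Xf ν u x) a' ≤ i.P.eps * a₀ ∧ colSumNorm (Xf ν u x) a' ≤ i.P.eps * a₀) →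
      (∀ ν, ∀ u ∈ ball (0 : E) R, ∀ x a', rowSumNorm (Xf ν u x - Xf ν u (Site.unshift x ν)) a' ≤ i.P.eps ^ 2 * a₁ ∧
        colSumNorm (Xf ν u x - Xf ν u (Site.unshift x ν)) a' ≤ i.P.eps ^ 2 * a₁) →
      (∀ u p q, Vav u p q ≠ 0 → cubeOf i.P p.1 = cubeOf i.P q.1) →
      (∀ u ∈ ball (0 : E) R, ∀ p, ∑ q, ‖Vav u p q‖ ≤ αav) →
      0 ≤ μ → 2 * μ ≤ ε → 2 * μ ≤ δ₀ / 2 - ε - μ → 0 ≤ cμ →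
      RowSum (toB6 (torusGeom (Nv i.P i.P.K) 0 0 0) 0 True) μ cμ →
      cμ * (cμ * 1 * (1 * (((i.P.d : ℝ) * (2 * (a₁ * Real.exp a₀) + 4 * (a₀ * Real.exp a₀) ^ 2) + αav +
        ∑ ι, (2 * (a₀ * Real.exp a₀) + (a₀ * Real.exp a₀) ^ 2) * covB i.P δ₀ ι) * C)) * cμ) * cμ < 1 →
      ∃ (W : Type) (T : W → (TPt dd N' → ℂ) → E → Matrix (Site i.P 0 × (Fin N × Fin N)) (Site i.P 0 × (Fin N × Fin N)) ℂ)
        (SX' : Set W) (A' : W → ℝ) (D' : W → UT (Nv i.P i.P.K) → UT (Nv i.P i.P.K) → ℝ),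
        BlockWalkExpansion c₀ (fun q : Site i.P 0 × (Fin N × Fin N) => cubeOf i.P q.1) (fun q => cubeOf i.P q.1)
          (fun (_ : TPt dd N' → ℂ) u =>
            Matrix.blockDiagonal (fun _ : Fin N × Fin N => ((tower i.P a msq).G i.P.K).map ((↑) : ℝ → ℂ)) *
              (1 - (covShift i.P (Fin N × Fin N) (fun ν u x => conjOp (exp (Xf ν u x)) (exp (-Xf ν u x)) - 1)
                  (fun ν u x => conjOp (exp (-Xf ν u (Site.unshift x ν))) (exp (Xf ν u (Site.unshift x ν))) - 1) u + Vav u) *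
                Matrix.blockDiagonal (fun _ : Fin N × Fin N => ((tower i.P a msq).G i.P.K).map ((↑) : ℝ → ℂ)))⁻¹) X R
          (ε - 2 * μ) (δ₀ / 2 - ε - μ - 2 * μ)
          (cμ * C * (1 * (1 - cμ * (cμ * 1 * (1 * (((i.P.d : ℝ) * (2 * (a₁ * Real.exp a₀) + 4 * (a₀ * Real.exp a₀) ^ 2) + αav +
            ∑ ι, (2 * (a₀ * Real.exp a₀) + (a₀ * Real.exp a₀) ^ 2) * covB i.P δ₀ ι) * C)) * cμ) * cμ)⁻¹) * cμ)
          T SX' A' D' (δ₀ / 2 - 2 * μ) ∧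
        (∀ (ι : Fin i.P.d ⊕ Fin i.P.d) ω (σ : TPt dd N' → ℂ), (∀ j, ‖σ j‖ ≤ Real.exp c₀.κ₁) → ∀ u ∈ ball (0 : E) R, ∀ Y Y',
          blockNorm (fun q : Site i.P 0 × (Fin N × Fin N) => cubeOf i.P q.1) (fun q => cubeOf i.P q.1)
              (covDop i.P (Fin N × Fin N) ι * T ω σ u) Y Y' ≤
            covB i.P δ₀ ι * (A' ω * Real.exp (-((δ₀ / 2 - 2 * μ) * D' ω Y Y')))) ∧
        ∀ ω, DomBy (toB6 (torusGeom (Nv i.P i.P.K) 0 0 0) 0 True) (D' ω) := by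
  obtain ⟨δ₀, C, hδ₀, hC, h⟩ := blockWalkExpansion_transport_oneScaleTorus (dd := dd) (N' := N') (E := E) (a := a) (msq := msq) hd hL ha hmsq
  refine ⟨δ₀, C, hδ₀, hC, fun i N c₀ X R Xf Vav a₀ a₁ αav ε μ cμ hUp hUpi hVavh ha₀ ha₁ hαav hw0 hw1 hloc hav hμ hμε hμκ hcμ hrow
    hq => ?_⟩
  have hε : 0 < i.P.eps := by unfold Params.eps; exact pow_pos (inv_pos.2 i.P.cast_L_pos) _
  have hε1 : i.P.eps ≤ 1 := by
    unfold Params.eps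
    exact pow_le_one₀ (inv_nonneg.2 i.P.cast_L_pos.le) (inv_le_one_of_one_le₀ (by exact_mod_cast i.P.hL.2.le))
  have hs : 0 ≤ i.P.eps * a₀ := by positivity
  -- the bond letter `e^{ηa₀} − 1 ≤ η(a₀e^{a₀})`
  have hb : Real.exp (i.P.eps * a₀) - 1 ≤ i.P.eps * (a₀ * Real.exp a₀) := exp_sub_one_le_eps hε.le hε1 ha₀
  -- the derivative letter `η²a₁e^{ηa₀} ≤ η²(a₁e^{a₀})`
  have hdl : i.P.eps ^ 2 * a₁ * Real.exp (i.P.eps * a₀) ≤ i.P.eps ^ 2 * (a₁ * Real.exp a₀) := by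
    rw [mul_assoc]
    exact mul_le_mul_of_nonneg_left (mul_le_mul_of_nonneg_left (Real.exp_le_exp.2 (by nlinarith)) ha₁) (by positivity)
  refine h i N c₀ X R (fun ν u x => exp (Xf ν u x)) (fun ν u x => exp (-Xf ν u x)) Vav (a₀ * Real.exp a₀) (a₁ * Real.exp a₀) αav
    ε μ cμ hUp hUpi hVavh (fun ν u x => by
      rw [Matrix.exp_neg]; exact Matrix.mul_nonsing_inv _ ((Matrix.isUnit_iff_isUnit_det _).1 (Matrix.isUnit_exp _))) (by positivity) (by positivity) hαav (fun ν u hu x a' => ?_)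
    (fun ν u hu x a' => ?_) hloc hav hμ hμε hμκ hcμ hrow hq
  · refine ⟨(rowSumNorm_exp_sub_one_le _ hs (fun b => (hw0 ν u hu x b).1) a').trans hb,
      (colSumNorm_exp_sub_one_le _ hs (fun b => (hw0 ν u hu x b).2) a').trans hb,
      (rowSumNorm_exp_sub_one_le _ hs (fun b => (rowSumNorm_neg (Xf ν u x) b).symm ▸ (hw0 ν u hu x b).1) a').trans hb,
      (colSumNorm_exp_sub_one_le _ hs (fun b => (colSumNorm_neg (Xf ν u x) b).symm ▸ (hw0 ν u hu x b).2) a').trans hb⟩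
  · exact ⟨(rowSumNorm_exp_sub_exp_le _ _ hs (by positivity) (fun b => (hw0 ν u hu x b).1) (fun b => (hw0 ν u hu _ b).1)
        (fun b => (hw1 ν u hu x b).1) a').trans hdl,
      (colSumNorm_exp_sub_exp_le _ _ hs (by positivity) (fun b => (hw0 ν u hu x b).2) (fun b => (hw0 ν u hu _ b).2)
        (fun b => (hw1 ν u hu x b).2) a').trans hdl⟩

end ExpTransport

end Summit.QuantumFields.BalabanUV.Gaps.D4WalkBlockExpTransport

end
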